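import Summits.QuantumFields.YangMills.Theorems.BalabanUVNodesN12NearFlatDelta2Letter
import Literature.MathematicalPhysics.QuantumFieldTheory.Balaban1983to89.Node00.MultiScaleFibreChartB
import Literature.MathematicalPhysics.QuantumFieldTheory.Balaban1983to89.Node00.MultiScaleFibreChartMultiplierB
import Summits.QuantumFields.YangMills.Theorems.BalabanUVNodesN12FlatChartDerivIterLinB
import Summits.QuantumFields.YangMills.Theorems.BalabanUVNodesN12GuardedChartDerivDeviationB
import HarnessLib

/-!
# DAG node N12 [B15] — THE LETTER (δ₂) OF THE ASSEMBLED ENDPOINT's PACKAGE (N) IN THE JUNCTION's CURRENCY, PER HEIGHT: `‖DΨ(0)w − DΦ♭(0)w‖ ≤ (C·‖↑U₀ − 1‖)·p(w)` for the chart of record — **BOND-DATUM EDITION** (`…N12NearFlatDelta2LetterB`, USED DECLARATIONS ONLY)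

The print-datum ([Balaban1984PropagatorsII] (2.3)) (γ) twin of `Summits/…/Theorems/BalabanUVNodesN12NearFlatDelta2Letter.lean`: the declarations of the parent whose STATEMENT reads the determining datum
(`exists_delta2_letter`) and which N12's junction of record v14ᴸ uses (dag-n12-c g35 probe-2 census `UsedConstsN12RoadTyped2`, THEOREMS block), re-typed over a
BOND-LEVEL datum `𝔅 : BDetSet` (F0a `B15DeterminingSetsB`) and dag-n12-c's bond-datum chart `Node00.msChartB` (✓p774329; `msChart 𝐁 = msChartB (bondsDet 𝐁)` by `rfl`).  GENERATOR twin
(this seat's `work/g32/gen_thm.py`, block-extracted from the parent's tree bytes): namespace `…N12NearFlatDelta2LetterB`, SAME short names, `DetSet ↦ BDetSet`, `AgreeOn 𝐁 ↦ AgreeOnB 𝔅`,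
`IsMinimizer ↦ IsMinimizerB`, `bondsOf (𝐁 j) ↦ 𝔅 j`, `msChart ∕ constrCard ∕ constrEnum ∕ ConstrSet ↦ …B`, NODE 00 chart lemmas `…msChart… ↦ …msChartB…`; proofs VERBATIM; the parent's
datum-free declarations REUSED BY NAME (`open`), never copied (private plumbing excepted, №366 R2).  The parent's (b) statements are the instances `𝔅 := bondsDet 𝐁`.

Cell `pub-ymgap` (HUMAN RULINGS D-0062 ∕ D-0149), seat `pub-ymgap-dag-n12-d` g32 (R134 N12 [B15] s2; the (ii) Theorems-side re-key of N12's road at print's [II] (2.3) datum — director-ym №338 ∕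
№343 (E1)(iii-b), FLAG №16 ∕ ruling (α); dag-n12-c DESIGN memo a793b2ebc0b803bf (ii); `N12-ROAD-TWIN-ORDER-2026-08-30.md`).  Count-neutral helper of K1⁹ `stmt-QuantumFields-27364`,
`--kind proof --supports … --as helper`.  THEOREMS ONLY (0 `def`, 0 `instance`, 0 `sorry`).

HONEST FRAMING (director-ym №338 (5)).  PURELY ADDITIVE: the parent stays landed and true on its own text; nothing in it is edited; no displayed premise of any consumer is deleted or
weakened; every hypothesis of the parent stays a hypothesis.  Nothing of Bałaban's analysis asserted; N12 NOT discharged; K0⁷ ∕ K1⁹ NOT closed; counts unmoved (typed 28∕28 · discharged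
8∕27, A 8∕28; K 1∕4); one finite 𝕋⁴ programme at fixed ε — R4 closes the conditional rung `BalabanLadder.UV` only; NOT the Yang–Mills mass gap (Clay); nothing continuum ∕ ℝ⁴ ∕ OS.

PARENT's DOCSTRING (the mathematics and the citations; read the site-level `𝐁` as the bond datum `𝔅`):
# DAG node N12 [B15] — THE LETTER (δ₂) OF THE ASSEMBLED ENDPOINT's PACKAGE (N) IN THE JUNCTION's CURRENCY, PER HEIGHT: `‖DΨ(0)w − DΦ♭(0)w‖ ≤ (C·‖↑U₀ − 1‖)·p(w)` for the chart of record
# `Ψ := msChart F N K k 𝐁 W U₀` against the FLAT chart `Φ♭ := msChart F N K k 𝐁 (M˙1) 1`, ONE `C, ρ` per height — dag-n10-w1's module D + dag-n12-w3's flat identification, re-keyed by name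

[Balaban1989LargeFieldII] = «[LF-II]», p. 357 («we write U₀ = exp(iA₀) and expand in A₀ up to first order»), (1.12) p. 359; [Balaban1985Variational] = «[15]», Sect. C (44)–(48) p. 285, (82)–(83) p. 290;
[Balaban1985Averaging], Prop. 3 (121)–(125) p. 36; [Balaban1988Convergent] = «[III]», (2.10)–(2.12) p. 256.

Cell `pub-ymgap`, HUMAN RULING D-0062 ∕ D-0149, width seat `pub-ymgap-dag-n12-w4` generation 3 (WIDTH SEAT 4 of 4 on N12; lane U2c; INBOX CLAIM-5 ∕ INTENT-5 of 2026-08-28).  `--kind proof --supports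
stmt-QuantumFields-20542 --as helper` (K1⁷; count-neutral).  NEW leaf; CONSUMED BY NAME, nothing modified: dag-n10-w1's module D `…N12GuardedChartDerivDeviation.exists_norm_fderiv_msChart_sub_suProj_iterLin_le`
(p601xxx lineage: `DΨ_{U₀}(0)` vs `π∘Q^{(j)}` at a guarded near-flat `U₀`, self-datum `M˙U₀`), dag-n12-w3∕n10-w1's `…N12FlatChartDerivIterLin.fderiv_msChart_one_apply_eq_iterLin` (the FLAT chart derivative IS
`π∘Q^{(j)}`), this seat's `Node00.MultiScaleFibreChartMultiplier.msChart_eq_msChart_avgFamily_of_agreeOn` (datum congruence: J-C's datum vs the self-datum) and dag-n12-w2's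
`B16Ineq19NearFlatSliceNorms.opNorm_coe_le_norm_lieSU`.

WHY.  The lane owner's assembled endpoint `B15Prop1EndpointNearFlatLetters` (p610003 ∕ p612688) binds per slice vector `X` the letter (δ₂) `hδ₂ : q(DΨ(0)(X_f′X) − Lf(X_f′X)) ≤ δ₂·p(X_f′X)` with `Ψ` the
chart of record at the background `U₀` and datum `W = M˙(Q_k^{s*}Ṽ)`, `Lf` the knit's flat linearised constraint.  dag-n10-w1's module D delivered the analytic content in sup-norm ∃-currency at the
SELF-datum `M˙(U₀)`; THIS MODULE re-keys it to the junction's shape: `Lf := DΦ♭(0)` the FLAT chart of record (the `Lf` of this seat's `hm` producer p611770 and of dag-n12-w3's `hnd` letters), `q := ‖·‖` on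
the constraint space (as in this seat's (μ) producers p613093 ∕ the uniform edition), ANY seminorm `p` with `Σ_b‖↑w_b‖²_op ≤ p(w)²`, the datum moved to `W` by the fibre condition — with `δ₂ := C·‖↑U₀ − 1‖`,
ONE `C, ρ` per height.

CONTENTS (namespace `Summit.QuantumFields.YangMills.BalabanUVNodes.N12NearFlatDelta2Letter`; theorems only — no `def`, no `instance`, no `sorry`).
* §1 `opNormField_le_seminorm` (`‖↑w‖_sup-op ≤ p(w)` from `hp`), `norm_sub_le_of_apply` (sup-norm bookkeeping).
* §3 ★★ `exists_rightInverse_fun_of_flat_of_delta2` (flat linear right inverse + pointwise (δ₂) ⟹ actual right inverse as a function, `p(Rv) ≤ ρ♭∕(1 − δ₂ρ♭)·‖v‖`), ★★★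
  `exists_rightInverse_fun_msChart_of_flat` (at the record: `hsurj` and the `R`-letter of `hlam`∕(μ) from ONE displayed object — the flat linear right inverse on `ConstrSet 𝐁 k`, way (ii)).
* §2 ★★★ `exists_delta2_letter` — ONE `C ≥ 0`, `ρ > 0` per height: for every guarded `U₀` (`Ū^i(U₀)` `t₀`-small below `k`, `stokesConst·t₀ < δ_N`) with `‖↑U₀ − 1‖ < ρ`, every `𝐁`, every datum `W`
  with `M˙(U₀) = W` on `𝐁`, and every direction `w`: `‖DΨ(0)w − DΦ♭(0)w‖ ≤ C·‖↑U₀ − 1‖·p(w)`; ★★ `exists_delta2_letter_Bj` (the record's `𝐁_k(Z)`).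

HONEST FRAMING ∕ LOCATED: composition by name; `C, ρ` are dag-n10-w1's per-height EXISTENCE constants («ρ′ EXISTS by smoothness constants; print's O(L²α₀) NOT claimed»), so (δ₂) here is
`O(‖↑U₀ − 1‖)` with a per-height constant, NOT print's volume-uniform one; the guard hypotheses are displayed as in module D; nothing of Bałaban's asserted; N12 NOT discharged; K1⁷ NOT closed;
counts unmoved (5∕27); one finite 𝕋⁴ programme at fixed ε — R4 closes the conditional finite-𝕋⁴ rung `BalabanLadder.UV` only; NOT continuum ∕ ℝ⁴ ∕ OS ∕ mass gap ∕ Clay.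
-/

noncomputable section

open scoped BigOperators Matrix.Norms.L2Operator Topology
open Filter Finset

namespace Summit.QuantumFields.YangMills.BalabanUVNodes.N12NearFlatDelta2LetterB

open Literature.MathematicalPhysics.QuantumFieldTheory.Balaban1983to89.B15DeterminingSetsB

open Literature.MathematicalPhysics.QuantumFieldTheory.Balaban1983to89
open T4Continuum (T4Family)
open BlockAveraging (blockAvg)
open ExpMeanLog (expMeanLogSU deltaSU)
open BlockAveragingEMLLinearised (linAvg)
open T4AdjointCovarianceUnitary (lieSU)
open B15DeterminingSets
open B14.Eq213DetSet (Bj)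
open Node00
open Summit.QuantumFields.YangMills.Theorems.BlockAvgCorrector (stokesConst)
open Summit.QuantumFields.YangMills.BalabanUVNodes.N12GuardedChartDerivDeviationB (exists_norm_fderiv_msChart_sub_suProj_iterLin_le)
open Summit.QuantumFields.YangMills.BalabanUVNodes.N12FlatChartDerivIterLinB (fderiv_msChart_one_apply_eq_iterLin)
open Summit.QuantumFields.YangMills.BalabanUVNodes.N12GuardedLinAvgRightInverse (exists_rightInverse_of_approx)
open B16Ineq19NearFlatSliceNorms (opNorm_coe_le_norm_lieSU)
open Summit.QuantumFields.YangMills.BalabanUVNodes.N12NearFlatDelta2Letter (opNormField_le_seminorm)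

section
variable {F : T4Family} {N : ℕ} [NeZero N] {K k : ℕ}

/-- ★★★ **THE LETTER (δ₂) OF THE PACKAGE (N), PER HEIGHT, IN THE JUNCTION's CURRENCY**: for the `linAvg`-recursion family `Q` and any seminorm `p` with `Σ_b‖↑w_b‖²_op ≤ p(w)²` there are ONE `C ≥ 0`
and ONE `ρ > 0` (dag-n10-w1's module D) such that for every guarded background `U₀` (iterated averages `t₀`-small below `k`, `stokesConst·t₀ < δ_N`) with `‖↑U₀ − 1‖ < ρ`, every determining set `𝐁`,
every datum `W` with `M˙(U₀) = W` on `𝐁`, and every direction `w`: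
`‖D(msChartB F N K k 𝐁 W U₀)(0) w − D(msChartB F N K k 𝐁 (M˙1) 1)(0) w‖ ≤ C·‖↑U₀ − 1‖·p(w)` — J-C's `hδ₂` with `Lf := DΦ♭(0)` (the flat chart of record), `q := ‖·‖`, `δ₂ := C·‖↑U₀ − 1‖`.
Proof: componentwise, module D bounds `‖(DΨ(0)w)_i − π(Q^{(j)}w)(c)‖` at the self-datum, dag-n12-w3∕n10-w1's flat identity says `π(Q^{(j)}w)(c) = (DΦ♭(0)w)_i`, the datum is moved to `W` by the
fibre condition (`msChartB_eq_msChartB_avgFamily_of_agreeOnB`), and `‖↑w‖ ≤ p(w)`. [cite: Balaban1989LargeFieldII, p.357, (1.12) p.359; Balaban1985Variational, Sect. C (44)–(48) p.285; Balaban1985Averaging, Prop. 3 (121)–(125) p.36; Balaban1988Convergent, (2.10)–(2.12) p.256] -/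
theorem exists_delta2_letter (k : ℕ)
    (Q : (i : ℕ) → (PBond (F.P K) 0 → Matrix (Fin N) (Fin N) ℂ) → PBond (F.P K) i → Matrix (Fin N) (Fin N) ℂ)
    (hQ0 : ∀ Y, Q 0 Y = Y) (hQs : ∀ (i : ℕ) (Y : PBond (F.P K) 0 → Matrix (Fin N) (Fin N) ℂ) (c : PBond (F.P K) (i + 1)), Q (i + 1) Y c = linAvg (Q i Y) c)
    (p : Seminorm ℝ (PBond (F.P K) 0 → lieSU (Fin N)))
    (hp : ∀ Y : PBond (F.P K) 0 → lieSU (Fin N), ∑ b, ‖(Y b : Matrix (Fin N) (Fin N) ℂ)‖ ^ 2 ≤ p Y ^ 2) :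
    ∃ C ρ : ℝ, 0 ≤ C ∧ 0 < ρ ∧ ∀ ⦃t₀ : ℝ⦄, 0 < t₀ → stokesConst (F.P K) * t₀ < deltaSU (Fin N) →
      ∀ (U₀ : GaugeField (F.P K) 0 (SU N)) (𝔅 : BDetSet (F.P K)) (W : MSField (F.P K) (SU N)),
        (∀ i, i < k → PlaqSmall t₀ (Averaging.iter (avOfRecord F N K) i U₀)) → ‖coeField U₀ - 1‖ < ρ →
        AgreeOnB 𝔅 (avgFamily (avOfRecord F N K) U₀) W →
        ∀ w : PBond (F.P K) 0 → lieSU (Fin N),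
          ‖fderiv ℝ (msChartB F N K k 𝔅 W U₀) 0 w
              - fderiv ℝ (msChartB F N K k 𝔅 (avgFamily (avOfRecord F N K) (1 : GaugeField (F.P K) 0 (SU N))) (1 : GaugeField (F.P K) 0 (SU N))) 0 w‖
            ≤ C * ‖coeField U₀ - 1‖ * p w := by
  obtain ⟨C, ρ, hC, hρ, hD⟩ := exists_norm_fderiv_msChart_sub_suProj_iterLin_le (F := F) (N := N) (K := K) (k := k) Q hQ0 hQs
  refine ⟨C, ρ, hC, hρ, fun t₀ ht₀ hstδ U₀ 𝔅 W hsm hU₀ hU w => ?_⟩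
  have hnn : 0 ≤ C * ‖coeField U₀ - 1‖ * p w := by
    have := apply_nonneg p w
    positivity
  rw [msChartB_eq_msChartB_avgFamily_of_agreeOnB (k := k) hU]
  refine (pi_norm_le_iff_of_nonneg hnn).2 fun i => ?_
  rw [Pi.sub_apply, fderiv_msChart_one_apply_eq_iterLin Q hQ0 hQs 𝔅 w i]
  exact (hD ht₀ hstδ U₀ hsm hU₀ 𝔅 w i).trans (mul_le_mul_of_nonneg_left (opNormField_le_seminorm p hp w) (by positivity))

end

end Summit.QuantumFields.YangMills.BalabanUVNodes.N12NearFlatDelta2LetterB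

end
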